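import Mathlib.NumberTheory.ArithmeticFunction.Moebius
import Mathlib.Analysis.Asymptotics.Lemmas
import Mathlib.Analysis.SpecialFunctions.Pow.Real
import Mathlib.Algebra.Order.Interval.Finset.SuccPred
import Mathlib.Data.Nat.Periodic
import Literature.NumberTheory.LFunctions.MoebiusAutomaticReductions
import Literature.NumberTheory.LFunctions.SiegelWalfiszMoebiusProofs
import HarnessLib

/-!
# Müllner's theorem, periodic component: `μ` is orthogonal to periodic sequences (proved)

Everything in this file is PROVED. In the printed proof of
`Literature.NumberTheory.LFunctions.mullner_moebius_automatic` (Müllner 2017, Thm. 1.2) the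
one-dimensional representations `D_ℓ` of the group of the naturally induced transducer contribute
sums of `μ` along arithmetic progressions (§4.3, and the Remark after Thm. 1.2: "Estimates for the
Möbius function along arithmetic progressions"); for a synchronizing automaton this is the WHOLE
contribution. This file supplies that input from the tree's (proved) Siegel–Walfisz theorem for `μ`
(`Literature.NumberTheory.LFunctions.SiegelWalfiszMoebius_holds`, Montgomery–Vaughan §11.3):

* `isLittleO_moebiusSum_residueClass`: `∑_{n ≤ N, n ≡ r (q)} μ(n) = o(N)` for every `q ≥ 1`, `r`;
* `isLittleO_moebiusSum_of_periodic`: `∑_{n ≤ N} f(n) μ(n) = o(N)` for every periodic `f : ℕ → ℂ`;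
* `isAutomaticSeq_of_periodic`: periodic sequences are `k`-automatic for every `k` (so these cases
  lie inside the scope of the fact; non-vacuity beyond constants).

## References
* C. Müllner, Duke Math. J. 166 (2017), Thm. 1.2 and §4.3. [Mullner2017]
* H. L. Montgomery, R. C. Vaughan, *Multiplicative Number Theory I*, CUP 2007, §11.3
  Exercise 13(f). [MontgomeryVaughan2007]
-/

noncomputable section

open Finset Filter Asymptotics
open scoped ArithmeticFunction.Moebius

namespace Literature.NumberTheory.LFunctions

/-! ## `μ` in arithmetic progressions is `o(N)` -/

/-- The Möbius sum of the indicator of a residue class, as a real sum over `1 ≤ n ≤ N` in the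
shape of `SiegelWalfiszMoebius` (`r < q`). [folklore] -/
theorem moebiusSum_residueClass_eq {q r : ℕ} (hr : r < q) (N : ℕ) :
    moebiusSum (fun n => if n % q = r then (1 : ℂ) else 0) N =
      ((∑ n ∈ (Icc 1 N).filter (fun n : ℕ => (n : ZMod q) = (r : ZMod q)), (μ n : ℝ) : ℝ) : ℂ) := by
  have hN : (0 : ℕ) < N + 1 := N.succ_pos
  rw [moebiusSum, sum_range_eq_add_Ico _ hN, Finset.Ico_add_one_right_eq_Icc, sum_filter]
  push_cast
  simp only [ArithmeticFunction.map_zero, Int.cast_zero, mul_zero, zero_add]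
  refine sum_congr rfl fun n _ => ?_
  simp only [ZMod.natCast_eq_natCast_iff', Nat.mod_eq_of_lt hr]
  split_ifs <;> simp

/-- `C x exp(−c√log x) = o(x)` along the naturals (`c > 0`). [folklore] -/
theorem isLittleO_mul_exp_neg_sqrt_log (C c : ℝ) (hc : 0 < c) :
    (fun N : ℕ => C * N * Real.exp (-c * Real.sqrt (Real.log N))) =o[atTop]
      fun N : ℕ => (N : ℝ) := by
  have h1 : (fun N : ℕ => (N : ℝ)) =O[atTop] fun N : ℕ => (N : ℝ) := isBigO_refl _ _
  have h2 : (fun N : ℕ => C * Real.exp (-c * Real.sqrt (Real.log N))) =o[atTop]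
      fun _ : ℕ => (1 : ℝ) := by
    rw [isLittleO_one_iff]
    have hlog : Tendsto (fun N : ℕ => Real.log N) atTop atTop :=
      Real.tendsto_log_atTop.comp tendsto_natCast_atTop_atTop
    have hsq : Tendsto (fun N : ℕ => -c * Real.sqrt (Real.log N)) atTop atBot :=
      (Real.tendsto_sqrt_atTop.comp hlog).const_mul_atTop_of_neg (neg_lt_zero.2 hc)
    have hexp := Real.tendsto_exp_atBot.comp hsq
    simpa using hexp.const_mul C
  have := h1.mul_isLittleO h2
  simp only [mul_one] at this
  refine this.congr' (Eventually.of_forall fun N => ?_) EventuallyEq.rfl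
  dsimp only
  ring

/-- **`μ` is `o(N)` on every residue class**: for `q ≥ 1` and any `r`,
`∑_{n ≤ N, n % q = r} μ(n) = o(N)`; from the Siegel–Walfisz theorem for `μ`
(`SiegelWalfiszMoebius_holds`, with `A = 1`, `x = N ≥ max(2, e^q)`). This is the input
"estimates for the Möbius function along arithmetic progressions" of Müllner's proof
(Remark after Thm. 1.2; §4.3, representations `D_ℓ`). [cite: Mullner2017, §4.3] -/
theorem isLittleO_moebiusSum_residueClass {q : ℕ} (hq : 0 < q) (r : ℕ) :
    moebiusSum (fun n => if n % q = r then (1 : ℂ) else 0) =o[atTop] fun N : ℕ => (N : ℝ) := by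
  rcases lt_or_ge r q with hr | hr
  · obtain ⟨c, hc, hall⟩ := SiegelWalfiszMoebius_holds
    obtain ⟨C, hC⟩ := hall 1 one_pos
    refine IsBigO.trans_isLittleO ?_ (isLittleO_mul_exp_neg_sqrt_log C c hc)
    refine IsBigO.of_bound 1 ?_
    have hev1 : ∀ᶠ N : ℕ in atTop, (2 : ℝ) ≤ N :=
      tendsto_natCast_atTop_atTop.eventually_ge_atTop 2
    have hev2 : ∀ᶠ N : ℕ in atTop, Real.exp q ≤ N :=
      tendsto_natCast_atTop_atTop.eventually_ge_atTop _
    filter_upwards [hev1, hev2] with N hN2 hNq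
    have hlog : (q : ℝ) ≤ Real.log N ^ (1 : ℝ) := by
      rw [Real.rpow_one, Real.le_log_iff_exp_le (by linarith)]
      exact hNq
    have h := hC N hN2 q hq hlog (r : ZMod q)
    rw [Nat.floor_natCast] at h
    rw [moebiusSum_residueClass_eq hr, Complex.norm_real, Real.norm_eq_abs, one_mul,
      Real.norm_of_nonneg ((abs_nonneg _).trans h)]
    exact h
  · have : (fun n : ℕ => if n % q = r then (1 : ℂ) else 0) = fun _ => 0 := by
      funext n
      rw [if_neg]
      exact ((Nat.mod_lt n hq).trans_le hr).ne
    rw [this]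
    have h0 : moebiusSum (fun _ => (0 : ℂ)) = fun _ => 0 := by
      funext N; simp [moebiusSum]
    rw [h0]
    exact isLittleO_zero _ _

/-! ## Periodic sequences -/

/-- A `q`-periodic sequence is the linear combination `f = ∑_{r < q} f(r) 𝟙_{n % q = r}`.
[folklore] -/
theorem eq_sum_residueClass_of_periodic {f : ℕ → ℂ} {q : ℕ} (hf : Function.Periodic f q)
    (hq : 0 < q) (n : ℕ) :
    f n = ∑ r ∈ range q, f r * (if n % q = r then (1 : ℂ) else 0) := by
  simp only [mul_ite, mul_one, mul_zero]
  rw [sum_ite_eq (range q) (n % q) (fun r => f r), if_pos (mem_range.2 (Nat.mod_lt n hq)),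
    hf.map_mod_nat]

/-- **`μ` is orthogonal to every periodic sequence**: if `f (n + q) = f n` (`q ≥ 1`) then
`∑_{n ≤ N} f(n) μ(n) = o(N)`. (The `D_ℓ`-part of Müllner's Prop. 3.2, §4.3; classical from the
prime number theorem in arithmetic progressions.) [cite: Mullner2017, §4.3] -/
theorem isLittleO_moebiusSum_of_periodic {f : ℕ → ℂ} {q : ℕ} (hf : Function.Periodic f q)
    (hq : 0 < q) : moebiusSum f =o[atTop] fun N : ℕ => (N : ℝ) := by
  have heq : moebiusSum f =
      moebiusSum (fun n => ∑ r ∈ range q, f r * (if n % q = r then (1 : ℂ) else 0)) := by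
    congr 1
    exact funext (eq_sum_residueClass_of_periodic hf hq)
  rw [heq]
  exact isLittleO_moebiusSum_finset_sum _ fun r _ =>
    isLittleO_moebiusSum_const_mul (f r) (isLittleO_moebiusSum_residueClass hq r)

/-- Shifts of residue-class indicators along the kernel maps stay periodic: if `f` is
`q`-periodic then so is `n ↦ f (m n + r)` for all `m, r`. [folklore] -/
theorem periodic_comp_affine {f : ℕ → ℂ} {q : ℕ} (hf : Function.Periodic f q) (m r : ℕ) :
    Function.Periodic (fun n => f (m * n + r)) q := by
  intro n
  have h := hf.nat_mul m
  simp only [Nat.cast_id] at h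
  simp only
  rw [mul_add, add_right_comm]
  exact h (m * n + r)

/-- **Periodic sequences are `k`-automatic for every `k`** (their `k`-kernel consists of
`q`-periodic sequences with values in the finite range of `f`). In particular the periodic case
of Müllner's theorem lies inside the scope of `mullner_moebius_automatic`. [folklore] -/
theorem isAutomaticSeq_of_periodic {f : ℕ → ℂ} {q : ℕ} (hf : Function.Periodic f q)
    (hq : 0 < q) (k : ℕ) : IsAutomaticSeq k f := by
  -- every kernel element is determined by its restriction to `{0, …, q-1}`, with values in `range f`
  let F : (Fin q → ℂ) → (ℕ → ℂ) := fun v n => v ⟨n % q, Nat.mod_lt n hq⟩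
  have hfin : (F '' Set.pi Set.univ (fun _ : Fin q => Set.range f)).Finite := by
    refine (Set.Finite.pi fun _ => ?_).image F
    have : Set.range f ⊆ f '' (Set.Iio q) := by
      rintro _ ⟨n, rfl⟩
      exact ⟨n % q, Nat.mod_lt n hq, hf.map_mod_nat n⟩
    exact ((Set.finite_Iio q).image f).subset this
  refine hfin.subset ?_
  rintro g ⟨i, -, r, -, rfl⟩
  refine ⟨fun j => f (k ^ i * j + r), fun j _ => ⟨_, rfl⟩, funext fun n => ?_⟩
  simp only [F]
  exact (periodic_comp_affine hf (k ^ i) r).map_mod_nat n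

end Literature.NumberTheory.LFunctions
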